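import Summits.BirchSwinnertonDyer.Rank1Residual.GaloisImage.HauptmodulNineTowerVZero
import Summits.BirchSwinnertonDyer.Rank1Residual.GaloisImage.HauptmodulNineValuationSeven
import HarnessLib

/-!
# The `3`-adic tower on the EXOTIC core at `v₃(j) = 7`, `j/3⁷ ∈ {1, 8, 5, 7} (mod 9)`:
# `ρ̄_{E,3}` onto implies `ρ̄_{E,3ⁿ}` onto for every `n` — via the level-`9` Hauptmodul and the
# unit normalisation (cell `b2b-bsdres`, team n1011, seat p02 gen 6 — row T-b11-F4
# 'scalar-stabiliser tower criterion at 9', file F4c-H17: the assembly at `v₃(j) = 7`)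

HONEST FRAMING (cell `b2b-bsdres`, run/shared/lean/b2b/bsd-rank1-residual/, verbatim in every
file): the goal of the cell is to DELETE the COMBINATION-SHAPED residual classes of the
Birch–Swinnerton-Dyer formula for ALL analytic-rank `≤ 1` elliptic curves over `ℚ` — "full BSD
formula for every rank `≤ 1` curve in class `C`" assembled STRICTLY from published theorems — so
that the rank-`≤ 1` remainder becomes exactly the CONSTRUCTION-SHAPED classes, which are TYPED
(missing-input `Prop`s), NOT attempted. This is not "finishing BSD". Team n1011 (N10 / N11):
research route; no claim beyond the stated classes; labels UNCHANGED; nothing is booked. Theorems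
only (no definition, no named fact).

## What this file proves

* **`towerSurj_three_of_surj_of_nine_dvd_num_seven_pm`** — for `E/ℚ` with `ρ̄_{E,3}` onto,
  `ε = ±1` and `9 ∣ num(j(E)/3⁷ − ε)` (i.e. `v₃(j) = 7` and `j/3⁷ ≡ ±1 (mod 9)`): `ρ̄_{E,3ⁿ}` is
  onto for every `n`.  Invariant `z = (9θ/(2(θ³ − 24)))² − 1` of valuation `4/9`
  (`HauptmodulNineValuationSeven`), scalar-stabiliser criterion with `(d, a, b) = (9, 0, 4)`.
* **`towerSurj_three_of_surj_of_nine_dvd_num_seven_e1`** — the same for `9 ∣ num(j/3⁷ − (ε − 3))`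
  (`j/3⁷ ≡ 7, 5 (mod 9)`), invariant `z = (81θ/(2(θ³ − 24)(θ³ − 15)))² − 1`.
* `imageContainsSL2_three_of_surj_of_nine_dvd_num_seven_pm` / `…_e1` — Kato's (12.5.2) at `p = 3`.

This discharges by a KERNEL PROOF the family `v₃(j) = 7`, `j/3⁷ ∈ {1, 8, 5, 7} (mod 9)` of the
EXOTIC core of the cell's `3`-adic census (41 of the 749 `m = 3` cells: 26 + 15; EVIDENCE kit
j135897, 41/41).  NOT claimed: `v₃(j) = 7` with `j/3⁷ ≡ 2, 4 (mod 9)` (27 cells) — there no prime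
of `ℚ(θ)` over `3` has `9 ∣ ef` (kit j135556), so no `Stab`-invariant of a CYCLIC `9`-group can
work.  Nothing booked; no label change.

References: [Maier2006] Table 4 (N = 3, 9), §5; [SerreAbelianLadic1968] IV-23;
[SerreLocalFields1979] Ch. I §7; [Kato2004Asterisque] (12.5.2).
-/

noncomputable section

set_option maxRecDepth 10000

open scoped Classical

open WeierstrassCurve Field

namespace Summit.BirchSwinnertonDyer.Rank1Residual.GaloisImage

open Literature.NumberTheory.EllipticCurves Literature.NumberTheory.GaloisRepresentations
  Rat.HeightOneSpectrum

variable (W : WeierstrassCurve ℚ) [W.IsElliptic]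

/-- The common curve side at `v₃(j) ≥ 4` (so `v₃(j − 1728) = 3`): a `9`-torsion point `Q` over a
non-canonical `3`-torsion group and the `Stab(ℤQ)`-invariant `θ = η(E, ℤQ) + 3 ∈ ℚ(E[9])` with
`j(θ³ − 27) = θ³(θ³ − 24)³` and `v(θ³) = v(3)`. [cite: Maier2006, Table 4 (N = 9) and §5] -/
theorem exists_nineTorsion_hauptmodulNine_of_four_le (hjV : 4 ≤ padicValRat 3 W.j) :
    ∃ (Q : W.geomPoints) (θ : AlgebraicClosure ℚ), Q ∈ geomTorsion W 9 ∧ θ ∈ W.divisionField 9 ∧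
      (∀ σ : absoluteGaloisGroup ℚ, (∃ c : ℤ, σ • Q = c • Q) → σ • θ = θ) ∧
      algebraMap ℚ (AlgebraicClosure ℚ) W.j * (θ ^ 3 - 27) = θ ^ 3 * (θ ^ 3 - 24) ^ 3 ∧
      (placeOver 3).valuation (θ ^ 3) = (placeOver 3).valuation (3 : AlgebraicClosure ℚ) := by
  haveI : Fact (Nat.Prime 3) := ⟨Nat.prime_three⟩
  have hj3 := padicValRat_j_sub_1728_of_four_le W hjV
  obtain ⟨Q, x₃, y₃, h₃, hQ9, hQ3, -, hvalS⟩ :=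
    exists_nineTorsion_hauptmodul_three_valuation W (m := 3) (by norm_num) (by norm_num) hj3
  have h3Q : (3 ^ 1 : ℕ) • Q ≠ 0 := by
    rw [pow_one, ← natCast_zsmul, Nat.cast_ofNat, hQ3]
    exact Affine.Point.some_ne_zero h₃
  have h9Q : (3 ^ (1 + 1) : ℕ) • Q = 0 := by
    rw [← natCast_zsmul]; exact_mod_cast hQ9
  have h9 : addOrderOf Q = 9 := by
    have := addOrderOf_eq_prime_pow h3Q h9Q
    norm_num at this
    exact this
  obtain ⟨θ, hθL, hθfix, hjθ, hSθ⟩ := exists_hauptmodulNine_invariant W h9 hQ3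
  have hSθ' : (W.map (algebraMap ℚ (AlgebraicClosure ℚ))).tgA₁ x₃ y₃ ^ 3 /
      (W.map (algebraMap ℚ (AlgebraicClosure ℚ))).tgA₃ x₃ y₃ = θ ^ 3 := hSθ
  rw [hSθ'] at hvalS
  have hvS : (placeOver 3).valuation (θ ^ 3) = (placeOver 3).valuation (3 : AlgebraicClosure ℚ) :=
    (pow_left_inj₀ zero_le zero_le three_ne_zero).mp hvalS
  exact ⟨Q, θ, (Submodule.mem_torsionBy_iff _ _).mpr hQ9, hθL, hθfix, hjθ, hvS⟩

/-- **THE TOWER AT `v₃(j) = 7`, `j/3⁷ ≡ ±1 (mod 9)`.**  For `E/ℚ` with `ρ̄_{E,3}` onto, `ε = ±1`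
and `9 ∣ num(j/3⁷ − ε)`, `ρ̄_{E,3ⁿ}` is onto for every `n` (level-`9` Hauptmodul: the
`Stab(ℤQ)`-invariant `z = (9θ/(2(θ³ − 24)))² − 1 ∈ ℚ(E[9])`, `θ = η(E, ℤQ) + 3`, has `3`-adic
valuation exactly `4/9`; scalar-stabiliser tower criterion).
[cite: SerreAbelianLadic1968, Ch. IV §3.4, Lemma 3 (IV-23)] [cite: Maier2006, Table 4 (N = 9) and §5] -/
theorem towerSurj_three_of_surj_of_nine_dvd_num_seven_pm (hsurj : W.HasSurjectiveModNGaloisRep 3)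
    {ε : ℤ} (hε : ε = 1 ∨ ε = -1) (hj0 : (9 : ℤ) ∣ (W.j / 3 ^ 7 - ε).num) (n : ℕ) :
    W.HasSurjectiveModNGaloisRep (3 ^ n : ℕ) := by
  haveI : Fact (Nat.Prime 3) := ⟨Nat.prime_three⟩
  set v := (placeOver 3).valuation with hv
  set t := v (3 : AlgebraicClosure ℚ) with ht
  have ht0 : t ≠ 0 := valuation_three_ne_zero
  have hε3 : ¬ (3 : ℤ) ∣ ε := by rcases hε with h | h <;> rw [h] <;> decide
  have hjV := (padicValRat_eq_of_nine_dvd_num_sub (V := 7) hε3 hj0).1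
  obtain ⟨Q, θ, hQ₉, hθL, hθfix, hjθ, hvS⟩ :=
    exists_nineTorsion_hauptmodulNine_of_four_le W (by rw [hjV]; norm_num)
  -- the curve-free core: `v(z)⁹ = t⁴`
  have hz := valuation_hauptmodul_nine_invariant_seven_pm_pow_nine hε hj0 hjθ hvS rfl
  have hz0 : (9 * θ / (2 * (θ ^ 3 - 24))) ^ 2 - 1 ≠ 0 := by
    intro h0
    rw [h0, map_zero, zero_pow (by norm_num)] at hz
    exact pow_ne_zero 4 ht0 hz.symm
  have hzL : (9 * θ / (2 * (θ ^ 3 - 24))) ^ 2 - 1 ∈ W.divisionField 9 :=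
    sub_mem (pow_mem (div_mem (mul_mem (ofNat_mem _ 9) hθL) (mul_mem (ofNat_mem _ 2)
      (sub_mem (pow_mem hθL 3) (ofNat_mem _ 24)))) 2) (one_mem _)
  have hfix : ∀ σ : absoluteGaloisGroup ℚ, (∃ c : ℤ, σ • Q = c • Q) →
      σ • ((9 * θ / (2 * (θ ^ 3 - 24))) ^ 2 - 1) = (9 * θ / (2 * (θ ^ 3 - 24))) ^ 2 - 1 := by
    intro σ hσ
    have hθ' : absoluteGaloisGroup.toAlgEquiv ℚ σ θ = θ := by
      rw [← absoluteGaloisGroup.smul_def]; exact hθfix σ hσ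
    rw [absoluteGaloisGroup.smul_def]
    simp only [map_sub, map_div₀, map_mul, map_pow, map_ofNat, map_one, hθ']
  -- the scalar-stabiliser tower criterion with `d = 9`, `a = 0`, `b = 4`
  have hval : v ((9 * θ / (2 * (θ ^ 3 - 24))) ^ 2 - 1) ^ 9 * t ^ 0 = t ^ 4 := by
    rw [pow_zero, mul_one]; exact hz
  have hcop : IsCoprime ((9 : ℕ) : ℤ) (((0 : ℕ) : ℤ) - ((4 : ℕ) : ℤ)) := ⟨1, 2, by norm_num⟩
  exact towerSurj_three_of_surj_of_valuation_of_smul_zmultiples W hsurj hQ₉ hzL hz0 hfix hval hcop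
    (dvd_refl 9) n

/-- **Kato's (12.5.2) at `p = 3` on the family `v₃(j) = 7`, `j/3⁷ ≡ ±1 (mod 9)`** from surj(3).
[cite: Kato2004Asterisque, (12.5.2) (p. 222)] [cite: SerreAbelianLadic1968, Ch. IV §3.4, Lemma 3 (IV-23)] -/
theorem imageContainsSL2_three_of_surj_of_nine_dvd_num_seven_pm
    (hsurj : W.HasSurjectiveModNGaloisRep 3) {ε : ℤ} (hε : ε = 1 ∨ ε = -1)
    (hj0 : (9 : ℤ) ∣ (W.j / 3 ^ 7 - ε).num) :
    Kato2004.ImageContainsSL2 W 3 := by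
  haveI : Fact (Nat.Prime 3) := ⟨Nat.prime_three⟩
  exact (Kato2004.imageContainsSL2_iff_forall_hasSurjectiveModNGaloisRep W 3).mpr
    (towerSurj_three_of_surj_of_nine_dvd_num_seven_pm W hsurj hε hj0)

/-- **THE TOWER AT `v₃(j) = 7`, `j/3⁷ ≡ 7, 5 (mod 9)`.**  For `E/ℚ` with `ρ̄_{E,3}` onto, `ε = ±1`
and `9 ∣ num(j/3⁷ − (ε − 3))`, `ρ̄_{E,3ⁿ}` is onto for every `n` (the `Stab(ℤQ)`-invariant
`z = (81θ/(2(θ³ − 24)(θ³ − 15)))² − 1 ∈ ℚ(E[9])` has `3`-adic valuation exactly `4/9` — the unit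
normalisation `X = Y/(1 + δ/3)` of the level-`9` Hauptmodul; scalar-stabiliser tower criterion).
[cite: SerreAbelianLadic1968, Ch. IV §3.4, Lemma 3 (IV-23)] [cite: Maier2006, Table 4 (N = 9) and §5] -/
theorem towerSurj_three_of_surj_of_nine_dvd_num_seven_e1 (hsurj : W.HasSurjectiveModNGaloisRep 3)
    {ε : ℤ} (hε : ε = 1 ∨ ε = -1) (hj0 : (9 : ℤ) ∣ (W.j / 3 ^ 7 - ((ε - 3 : ℤ) : ℚ)).num) (n : ℕ) :
    W.HasSurjectiveModNGaloisRep (3 ^ n : ℕ) := by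
  haveI : Fact (Nat.Prime 3) := ⟨Nat.prime_three⟩
  set v := (placeOver 3).valuation with hv
  set t := v (3 : AlgebraicClosure ℚ) with ht
  have ht0 : t ≠ 0 := valuation_three_ne_zero
  have hc3 : ¬ (3 : ℤ) ∣ (ε - 3) := by rcases hε with h | h <;> rw [h] <;> decide
  have hjV := (padicValRat_eq_of_nine_dvd_num_sub (V := 7) hc3 hj0).1
  obtain ⟨Q, θ, hQ₉, hθL, hθfix, hjθ, hvS⟩ :=
    exists_nineTorsion_hauptmodulNine_of_four_le W (by rw [hjV]; norm_num)
  -- the curve-free core: `v(z)⁹ = t⁴`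
  have hz := valuation_hauptmodul_nine_invariant_seven_e1_pow_nine hε hj0 hjθ hvS rfl
  have hz0 : (81 * θ / (2 * (θ ^ 3 - 24) * (θ ^ 3 - 15))) ^ 2 - 1 ≠ 0 := by
    intro h0
    rw [h0, map_zero, zero_pow (by norm_num)] at hz
    exact pow_ne_zero 4 ht0 hz.symm
  have hzL : (81 * θ / (2 * (θ ^ 3 - 24) * (θ ^ 3 - 15))) ^ 2 - 1 ∈ W.divisionField 9 :=
    sub_mem (pow_mem (div_mem (mul_mem (ofNat_mem _ 81) hθL) (mul_mem (mul_mem (ofNat_mem _ 2)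
      (sub_mem (pow_mem hθL 3) (ofNat_mem _ 24))) (sub_mem (pow_mem hθL 3) (ofNat_mem _ 15)))) 2)
      (one_mem _)
  have hfix : ∀ σ : absoluteGaloisGroup ℚ, (∃ c : ℤ, σ • Q = c • Q) →
      σ • ((81 * θ / (2 * (θ ^ 3 - 24) * (θ ^ 3 - 15))) ^ 2 - 1) =
        (81 * θ / (2 * (θ ^ 3 - 24) * (θ ^ 3 - 15))) ^ 2 - 1 := by
    intro σ hσ
    have hθ' : absoluteGaloisGroup.toAlgEquiv ℚ σ θ = θ := by
      rw [← absoluteGaloisGroup.smul_def]; exact hθfix σ hσ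
    rw [absoluteGaloisGroup.smul_def]
    simp only [map_sub, map_div₀, map_mul, map_pow, map_ofNat, map_one, hθ']
  -- the scalar-stabiliser tower criterion with `d = 9`, `a = 0`, `b = 4`
  have hval : v ((81 * θ / (2 * (θ ^ 3 - 24) * (θ ^ 3 - 15))) ^ 2 - 1) ^ 9 * t ^ 0 = t ^ 4 := by
    rw [pow_zero, mul_one]; exact hz
  have hcop : IsCoprime ((9 : ℕ) : ℤ) (((0 : ℕ) : ℤ) - ((4 : ℕ) : ℤ)) := ⟨1, 2, by norm_num⟩
  exact towerSurj_three_of_surj_of_valuation_of_smul_zmultiples W hsurj hQ₉ hzL hz0 hfix hval hcop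
    (dvd_refl 9) n

/-- **Kato's (12.5.2) at `p = 3` on the family `v₃(j) = 7`, `j/3⁷ ≡ 7, 5 (mod 9)`** from surj(3).
[cite: Kato2004Asterisque, (12.5.2) (p. 222)] [cite: SerreAbelianLadic1968, Ch. IV §3.4, Lemma 3 (IV-23)] -/
theorem imageContainsSL2_three_of_surj_of_nine_dvd_num_seven_e1
    (hsurj : W.HasSurjectiveModNGaloisRep 3) {ε : ℤ} (hε : ε = 1 ∨ ε = -1)
    (hj0 : (9 : ℤ) ∣ (W.j / 3 ^ 7 - ((ε - 3 : ℤ) : ℚ)).num) :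
    Kato2004.ImageContainsSL2 W 3 := by
  haveI : Fact (Nat.Prime 3) := ⟨Nat.prime_three⟩
  exact (Kato2004.imageContainsSL2_iff_forall_hasSurjectiveModNGaloisRep W 3).mpr
    (towerSurj_three_of_surj_of_nine_dvd_num_seven_e1 W hsurj hε hj0)

end Summit.BirchSwinnertonDyer.Rank1Residual.GaloisImage
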